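import Mathlib
import Summits.NavierStokesRegularity.NavierStokesRegularity.Theorems.EulerZoomLiouvillePowerGaugeEulerLiouvilleDSSSimilarityNodes
import HarnessLib.Audit

/-!
# Crux E `PowerGaugeEulerLiouville` (stmt-NavierStokesRegularity-19832): A RESTING TRAJECTORY OF A DSS MEMBER CLUSTERS ON PERMANENT NODES —
# and CONVERGES to one of them along the phase lattice when the permanent nodes of the confining ball are finitely many
# (width seat ns-cas-k2 g3, lane «DSS thin vortical nodes», tool C part 1)

Route `EulerZoomLiouville` (NavierStokesRegularity), crux E.  Physical variables, g2's conventions (`…DSSSimilarityNodes`): `u` classical Euler on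
`(−∞,0)`, `l`-DSS for the class scaling (`T = l^{2+ρ}`, `n = 1/(2+ρ)`); `X` a particle path whose SIMILARITY SPEED
`(−s)^{1−n}‖u(s,X(s)) + (n/(−s))X(s)‖` tends to `0` as `s → −∞` (REST); similarity positions `y(s) = (−s)^{−n}X(s)`.
* `permanentNode_of_tendsto_simPos` — the limit of the similarity positions along ANY sequence of times `s_j → −∞` is a PERMANENT NODE
  (`u(t,(−t)ⁿy*) = −n(−t)^{n−1}y*` for all `t < 0`): g2's cluster argument (period-translates of every phase visit every window + slow motion at
  rest), isolated as a lemma;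
* `tendsto_simPos_of_tendsto_lattice` — if the phase-lattice positions `y(Tʲτ₀)` converge to `y*`, then `y(s_j) → y*` along every `s_j → −∞`
  (slow motion over less than one period);
* `exists_separation_of_finite` — a finite set of points has a positive separation;
* **`exists_tendsto_lattice_of_finite_nodes`** — `X` confined (`‖X(s)‖ ≤ R(−s)ⁿ` for `s ≤ τ₀`) and resting, and the permanent nodes of the
  closed ball `‖y‖ ≤ R` FINITE ⇒ the phase-lattice positions `y(Tʲτ₀)` CONVERGE to a permanent node `y*` of the ball.

WHAT THIS IS NOT: not NS regularity, not the crux E — Lagrangian bookkeeping for hypothetical DSS blow-up members; 19832 is OPEN. [folklore]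
-/

noncomputable section

set_option linter.dupNamespace false

open MeasureTheory Set Filter Topology Metric Function
open scoped NNReal ENNReal ContDiff InnerProductSpace RealInnerProductSpace

namespace Summit.NavierStokesRegularity.NavierStokesRegularity.Theorems.PowerGaugeEulerLiouville.DSSNodes

open Literature.Analysis Literature.Analysis.FluidPDE
open Summit.NavierStokesRegularity.NavierStokesRegularity.Theorems.PowerGaugeEulerLiouville.SimilarityBernoulli

variable {u : ℝ → EuclideanSpace ℝ (Fin 3) → EuclideanSpace ℝ (Fin 3)} {p : ℝ → EuclideanSpace ℝ (Fin 3) → ℝ} {ρ l : ℝ}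

/-! ### Limits of similarity positions along times `s_j → −∞` are permanent nodes -/

/-- **CLUSTER POINTS ARE PERMANENT NODES.**  `(u,p)` classical on `(−∞,0)`, `l`-DSS; `X` a particle path at rest in similarity variables;
`s_j < 0`, `s_j → −∞`, and the similarity positions `(−s_j)^{−n}X(s_j) → y*`.  Then `u(t,(−t)ⁿy*) = −n(−t)^{n−1}y*` for every `t < 0`.
[folklore] -/
theorem permanentNode_of_tendsto_simPos (hcl : IsClassicalEulerSolutionOn (Iio 0) 0 u p) (hl : 1 < l) (hρ : 0 < 2 + ρ)
    (hdss : ∀ τ : ℝ, τ < 0 → ∀ y, u τ y = (l ^ (1 + ρ)) • u ((l ^ (2 + ρ)) * τ) (l • y))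
    {X : ℝ → EuclideanSpace ℝ (Fin 3)} (hX : ∀ s : ℝ, s < 0 → HasDerivAt X (u s (X s)) s)
    (hrest : Tendsto (fun s => (-s) ^ (1 - (2 + ρ)⁻¹) * ‖u s (X s) + ((2 + ρ)⁻¹ / (-s)) • X s‖) atBot (𝓝 0))
    {sq : ℕ → ℝ} (hsq0 : ∀ j, sq j < 0) (hsq : Tendsto sq atTop atBot) {ys : EuclideanSpace ℝ (Fin 3)}
    (hy : Tendsto (fun j => ((-sq j) ^ (-(2 + ρ)⁻¹)) • X (sq j)) atTop (𝓝 ys)) :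
    ∀ t : ℝ, t < 0 → u t ((-t) ^ (2 + ρ)⁻¹ • ys) = (-((2 + ρ)⁻¹ * (-t) ^ ((2 + ρ)⁻¹ - 1))) • ys := by
  -- adapted from `SimilarityBernoulli.eventually_subcritical_of_permanentNodes` (…DSSSimilarityNodes), the «ys is a permanent node» block
  have hl0 : 0 < l := zero_lt_one.trans hl
  set n : ℝ := (2 + ρ)⁻¹ with hn
  set T : ℝ := l ^ (2 + ρ) with hT
  have hT1 : 1 < T := Real.one_lt_rpow hl hρ
  have hT0 : 0 < T := zero_lt_one.trans hT1
  have hneg_inv : ∀ s : ℝ, s < 0 → (-s) ^ (-n) = ((-s) ^ n)⁻¹ := fun s hs => Real.rpow_neg (by linarith) n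
  intro t ht
  have ht0' : 0 < -t := by linarith
  -- shift so that `s_{j+j₀} ≤ t`
  obtain ⟨j₀, hj₀⟩ := eventually_atTop.1 (hsq.eventually (eventually_le_atBot t))
  have hle : ∀ j : ℕ, sq (j + j₀) ≤ t := fun j => hj₀ _ (Nat.le_add_left _ _)
  choose m' hm'1 hm'2 using fun j => exists_pow_mul_mem_window hT1 ht (hle j)
  set s' : ℕ → ℝ := fun j => T ^ (m' j) * t with hs'
  have hs'le : ∀ j, s' j ≤ sq (j + j₀) := fun j => (hm'2 j).le
  have hs'0 : ∀ j, s' j < 0 := fun j => lt_of_le_of_lt (hs'le j) (hsq0 _)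
  set y' : ℕ → EuclideanSpace ℝ (Fin 3) := fun j => ((-s' j) ^ (-n)) • X (s' j) with hy'
  set G : EuclideanSpace ℝ (Fin 3) → EuclideanSpace ℝ (Fin 3) :=
    fun y => (-t) ^ (1 - n) • (u t ((-t) ^ n • y) + (n / (-t)) • ((-t) ^ n • y)) with hG
  have hGV : ∀ j, G (y' j) = (-s' j) ^ (1 - n) • (u (s' j) (X (s' j)) + (n / (-s' j)) • X (s' j)) := by
    intro j
    have hp : 0 < (-s' j) ^ n := Real.rpow_pos_of_pos (by linarith [hs'0 j]) _
    have hx : l ^ (m' j) • ((-t) ^ n • y' j) = X (s' j) := by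
      simp only [hy']
      rw [smul_smul, smul_smul, pow_mul_rpow_eq hl hρ (m' j) ht, ← hT, hneg_inv _ (hs'0 j), mul_inv_cancel₀ hp.ne',
        one_smul]
    have h := simVel_dss_iterate hl hρ hdss (m' j) ht ((-t) ^ n • y' j)
    rw [hx, ← hT] at h
    simp only [hG]
    exact h.symm
  -- `s' j → −∞`, hence the similarity velocity there tends to `0`
  have hsq_shift : Tendsto (fun j : ℕ => sq (j + j₀)) atTop atBot := hsq.comp (tendsto_add_atTop_nat j₀)
  have hs'_bot : Tendsto s' atTop atBot := tendsto_atBot_mono hs'le hsq_shift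
  have hG0 : Tendsto (fun j => G (y' j)) atTop (𝓝 0) := by
    refine tendsto_zero_iff_norm_tendsto_zero.2 ((hrest.comp hs'_bot).congr fun j => ?_)
    simp only [Function.comp_apply, hGV j, norm_smul, Real.norm_eq_abs,
      abs_of_nonneg (Real.rpow_nonneg (by linarith [hs'0 j] : (0:ℝ) ≤ -s' j) _)]
  -- `y' j − y(s_{j+j₀}) → 0`: over one period the resting orbit moves by `o(1)`
  have hdiff : Tendsto (fun j => ‖y' j - ((-sq (j + j₀)) ^ (-n)) • X (sq (j + j₀))‖) atTop (𝓝 0) := by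
    rw [Metric.tendsto_atTop]
    intro ε hε
    have hε' : 0 < ε / (2 * T) := by positivity
    obtain ⟨N, hN⟩ := eventually_atBot.1 (hrest.eventually (gt_mem_nhds hε'))
    obtain ⟨J, hJ⟩ := eventually_atTop.1 (hsq_shift.eventually (eventually_le_atBot N))
    refine ⟨J, fun j hj => ?_⟩
    rw [dist_zero_right, norm_norm]
    have hsN : sq (j + j₀) ≤ N := hJ j hj
    have hmv := norm_simPos_sub_le (n := n) (T := T) (ε := ε / (2 * T)) (hsq0 (j + j₀)) (hs'le j) (hm'1 j) hX
      (fun σ hσ => by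
        rw [norm_smul, Real.norm_eq_abs, abs_of_nonneg (Real.rpow_nonneg (by linarith [hσ.2, hsq0 (j + j₀)]) _)]
        exact (hN σ (hσ.2.trans hsN)).le)
    rw [← norm_neg, neg_sub] at hmv
    simp only [hy']
    refine lt_of_le_of_lt hmv ?_
    rw [div_mul_eq_mul_div, div_lt_iff₀ (by positivity)]
    nlinarith
  have hy'lim : Tendsto y' atTop (𝓝 ys) := by
    have hyφ : Tendsto (fun j => ((-sq (j + j₀)) ^ (-n)) • X (sq (j + j₀))) atTop (𝓝 ys) :=
      hy.comp (tendsto_add_atTop_nat j₀)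
    rw [tendsto_iff_norm_sub_tendsto_zero] at hyφ ⊢
    refine squeeze_zero (fun j => norm_nonneg _) (fun j => ?_) (hdiff.add hyφ |>.trans_eq (by simp))
    calc ‖y' j - ys‖ = ‖(y' j - ((-sq (j + j₀)) ^ (-n)) • X (sq (j + j₀))) + (((-sq (j + j₀)) ^ (-n)) • X (sq (j + j₀)) - ys)‖ := by
          rw [sub_add_sub_cancel]
      _ ≤ ‖y' j - ((-sq (j + j₀)) ^ (-n)) • X (sq (j + j₀))‖ + ‖((-sq (j + j₀)) ^ (-n)) • X (sq (j + j₀)) - ys‖ := norm_add_le _ _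
  -- continuity of `G` and the node equation at phase `t`
  have hGc : Continuous G := by
    have hu : Continuous (u t) := ((hcl.contDiff_velocity (mem_Iio.2 ht)).of_le (by norm_cast)).continuous
    simp only [hG]
    exact ((hu.comp (continuous_id.const_smul ((-t) ^ n))).add
      ((continuous_id.const_smul ((-t) ^ n)).const_smul (n / (-t)))).const_smul ((-t) ^ (1 - n))
  have hGys : G ys = 0 := tendsto_nhds_unique ((hGc.tendsto ys).comp hy'lim) hG0
  have hpow0 : (-t) ^ (1 - n) ≠ 0 := (Real.rpow_pos_of_pos ht0' _).ne'
  simp only [hG, smul_eq_zero, hpow0, false_or] at hGys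
  rw [eq_neg_of_add_eq_zero_left hGys, smul_smul, ← neg_smul, Real.rpow_sub_one ht0'.ne']
  congr 1
  field_simp

/-! ### From the phase lattice to all times -/

/-- For `s ≤ τ₀ < 0` and `T > 1` there is `m : ℕ` with `T^{m+1}τ₀ < s ≤ T^m τ₀`. [folklore] -/
theorem exists_lattice_window {T τ₀ s : ℝ} (hT : 1 < T) (hτ₀ : τ₀ < 0) (hs : s ≤ τ₀) :
    ∃ m : ℕ, T ^ (m + 1) * τ₀ < s ∧ s ≤ T ^ m * τ₀ := by
  have hT0 : 0 < T := zero_lt_one.trans hT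
  have hx : 0 < s / τ₀ := div_pos_of_neg_of_neg (by linarith) hτ₀
  obtain ⟨k, hk1, hk2⟩ := exists_mem_Ico_zpow hx hT
  have hx1 : 1 ≤ s / τ₀ := by rw [le_div_iff_of_neg hτ₀]; linarith
  have hk0 : 0 ≤ k := by
    by_contra h
    push Not at h
    have : T ^ (k + 1) ≤ T ^ (0 : ℤ) := zpow_le_zpow_right₀ hT.le (by omega)
    rw [zpow_zero] at this
    linarith
  lift k to ℕ using hk0
  refine ⟨k, ?_, ?_⟩
  · have h2 : s / τ₀ < T ^ (k + 1) := by exact_mod_cast hk2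
    rw [div_lt_iff_of_neg hτ₀] at h2
    linarith
  · have h1 : T ^ k ≤ s / τ₀ := by exact_mod_cast hk1
    rw [le_div_iff_of_neg hτ₀] at h1
    linarith

/-- **FROM THE PHASE LATTICE TO ALL TIMES.**  If the similarity positions at the lattice times `Tʲτ₀` converge to `y*` and the trajectory is at rest,
then the similarity positions converge to `y*` along every sequence `s_j → −∞` with `s_j ≤ τ₀`. [folklore] -/
theorem tendsto_simPos_of_tendsto_lattice (hl : 1 < l) (hρ : 0 < 2 + ρ)
    {X : ℝ → EuclideanSpace ℝ (Fin 3)} (hX : ∀ s : ℝ, s < 0 → HasDerivAt X (u s (X s)) s)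
    (hrest : Tendsto (fun s => (-s) ^ (1 - (2 + ρ)⁻¹) * ‖u s (X s) + ((2 + ρ)⁻¹ / (-s)) • X s‖) atBot (𝓝 0))
    {τ₀ : ℝ} (hτ₀ : τ₀ < 0) {ys : EuclideanSpace ℝ (Fin 3)}
    (hlat : Tendsto (fun j : ℕ => ((-((l ^ (2 + ρ)) ^ j * τ₀)) ^ (-(2 + ρ)⁻¹)) • X ((l ^ (2 + ρ)) ^ j * τ₀)) atTop (𝓝 ys))
    {sq : ℕ → ℝ} (hsqτ : ∀ j, sq j ≤ τ₀) (hsq : Tendsto sq atTop atBot) :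
    Tendsto (fun j => ((-sq j) ^ (-(2 + ρ)⁻¹)) • X (sq j)) atTop (𝓝 ys) := by
  have hl0 : 0 < l := zero_lt_one.trans hl
  set n : ℝ := (2 + ρ)⁻¹ with hn
  set T : ℝ := l ^ (2 + ρ) with hT
  have hT1 : 1 < T := Real.one_lt_rpow hl hρ
  have hT0 : 0 < T := zero_lt_one.trans hT1
  have hsq0 : ∀ j, sq j < 0 := fun j => lt_of_le_of_lt (hsqτ j) hτ₀
  choose m hm1 hm2 using fun j => exists_lattice_window hT1 hτ₀ (hsqτ j)
  set Y : ℕ → EuclideanSpace ℝ (Fin 3) := fun j => ((-(T ^ j * τ₀)) ^ (-n)) • X (T ^ j * τ₀) with hY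
  -- `m j → ∞`
  have hm_top : Tendsto m atTop atTop := by
    rw [tendsto_atTop_atTop]
    intro b
    obtain ⟨J, hJ⟩ := eventually_atTop.1 (hsq.eventually (eventually_lt_atBot (T ^ b * τ₀)))
    refine ⟨J, fun j hj => ?_⟩
    by_contra h
    push Not at h
    have h1 : T ^ (m j + 1) ≤ T ^ b := pow_le_pow_right₀ hT1.le (by omega)
    have h2 : T ^ b * τ₀ ≤ T ^ (m j + 1) * τ₀ := mul_le_mul_of_nonpos_right h1 hτ₀.le
    linarith [hJ j hj, hm1 j]
  -- `‖y(s_j) − Y(m j)‖ → 0` by slow motion on `[T^{m+1}τ₀, T^m τ₀] ∋ s_j`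
  have hdiff : Tendsto (fun j => ‖((-sq j) ^ (-n)) • X (sq j) - Y (m j)‖) atTop (𝓝 0) := by
    rw [Metric.tendsto_atTop]
    intro ε hε
    have hε' : 0 < ε / (2 * T) := by positivity
    obtain ⟨N, hN⟩ := eventually_atBot.1 (hrest.eventually (gt_mem_nhds hε'))
    obtain ⟨J, hJ⟩ := eventually_atTop.1 ((hm_top.eventually
      (((tendsto_pow_atTop_atTop_of_one_lt hT1).atTop_mul_const_of_neg hτ₀).eventually (eventually_le_atBot N))))
    refine ⟨J, fun j hj => ?_⟩
    rw [dist_zero_right, norm_norm]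
    have hsN : T ^ m j * τ₀ ≤ N := hJ j hj
    have hTm0 : T ^ m j * τ₀ < 0 := mul_neg_of_pos_of_neg (pow_pos hT0 _) hτ₀
    have hTs : T * (T ^ m j * τ₀) ≤ sq j := by
      have h := hm1 j
      rw [pow_succ] at h
      nlinarith
    have hmv := norm_simPos_sub_le (u := u) (n := n) (T := T) (ε := ε / (2 * T)) (s' := sq j) (s := T ^ m j * τ₀)
      hTm0 (hm2 j) hTs hX
      (fun σ hσ => by
        rw [norm_smul, Real.norm_eq_abs, abs_of_nonneg (Real.rpow_nonneg (by linarith [hσ.2]) _)]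
        exact (hN σ (hσ.2.trans hsN)).le)
    rw [← norm_neg, neg_sub] at hmv
    simp only [hY]
    refine lt_of_le_of_lt hmv ?_
    rw [div_mul_eq_mul_div, div_lt_iff₀ (by positivity)]
    nlinarith
  have hYm : Tendsto (fun j => Y (m j)) atTop (𝓝 ys) := hlat.comp hm_top
  rw [tendsto_iff_norm_sub_tendsto_zero] at hYm ⊢
  refine squeeze_zero (fun j => norm_nonneg _) (fun j => ?_) (hdiff.add hYm |>.trans_eq (by simp))
  calc ‖((-sq j) ^ (-n)) • X (sq j) - ys‖ = ‖(((-sq j) ^ (-n)) • X (sq j) - Y (m j)) + (Y (m j) - ys)‖ := by rw [sub_add_sub_cancel]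
    _ ≤ ‖((-sq j) ^ (-n)) • X (sq j) - Y (m j)‖ + ‖Y (m j) - ys‖ := norm_add_le _ _

/-! ### Convergence along the phase lattice when the permanent nodes of the ball are finitely many -/

/-- A finite set of points of a metric space is uniformly separated. [folklore] -/
theorem exists_separation_of_finite {α : Type*} [MetricSpace α] {N : Set α} (hN : N.Finite) :
    ∃ δ : ℝ, 0 < δ ∧ ∀ z ∈ N, ∀ z' ∈ N, z ≠ z' → δ ≤ dist z z' := by
  set S : Set ℝ := (fun q : α × α => dist q.1 q.2) '' N.offDiag with hS
  have hSf : S.Finite := hN.offDiag.image _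
  by_cases hSe : S = ∅
  · refine ⟨1, one_pos, fun z hz z' hz' hne => ?_⟩
    have : dist z z' ∈ S := ⟨(z, z'), ⟨hz, hz', hne⟩, rfl⟩
    rw [hSe] at this
    exact absurd this (notMem_empty _)
  · have hne : hSf.toFinset.Nonempty := by
      rw [Set.Finite.toFinset_nonempty]
      exact Set.nonempty_iff_ne_empty.2 hSe
    refine ⟨hSf.toFinset.min' hne, ?_, fun z hz z' hz' hzz => ?_⟩
    · have hmem := hSf.toFinset.min'_mem hne
      rw [Set.Finite.mem_toFinset] at hmem
      obtain ⟨q, hq, hq'⟩ := hmem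
      rw [← hq']
      exact dist_pos.2 hq.2.2
    · exact hSf.toFinset.min'_le _ (by rw [Set.Finite.mem_toFinset]; exact ⟨(z, z'), ⟨hz, hz', hzz⟩, rfl⟩)

/-- **CONVERGENCE TO ONE NODE.**  `(u,p)` classical on `(−∞,0)`, `l`-DSS; `X` a particle path confined to `‖X(s)‖ ≤ R(−s)ⁿ` for `s ≤ τ₀` and at
rest; the permanent nodes `y*` of the closed ball `‖y*‖ ≤ R` form a FINITE set.  Then the similarity positions at the lattice times `Tʲτ₀` converge
to a permanent node of that ball. [folklore] -/
theorem exists_tendsto_lattice_of_finite_nodes (hcl : IsClassicalEulerSolutionOn (Iio 0) 0 u p) (hl : 1 < l) (hρ : 0 < 2 + ρ)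
    (hdss : ∀ τ : ℝ, τ < 0 → ∀ y, u τ y = (l ^ (1 + ρ)) • u ((l ^ (2 + ρ)) * τ) (l • y))
    {X : ℝ → EuclideanSpace ℝ (Fin 3)} (hX : ∀ s : ℝ, s < 0 → HasDerivAt X (u s (X s)) s)
    (hrest : Tendsto (fun s => (-s) ^ (1 - (2 + ρ)⁻¹) * ‖u s (X s) + ((2 + ρ)⁻¹ / (-s)) • X s‖) atBot (𝓝 0))
    {τ₀ R : ℝ} (hτ₀ : τ₀ < 0) (hconf : ∀ s : ℝ, s ≤ τ₀ → ‖X s‖ ≤ R * (-s) ^ (2 + ρ)⁻¹)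
    (hfin : {y : EuclideanSpace ℝ (Fin 3) | ‖y‖ ≤ R ∧
      ∀ t : ℝ, t < 0 → u t ((-t) ^ (2 + ρ)⁻¹ • y) = (-((2 + ρ)⁻¹ * (-t) ^ ((2 + ρ)⁻¹ - 1))) • y}.Finite) :
    ∃ ys : EuclideanSpace ℝ (Fin 3), ‖ys‖ ≤ R ∧
      (∀ t : ℝ, t < 0 → u t ((-t) ^ (2 + ρ)⁻¹ • ys) = (-((2 + ρ)⁻¹ * (-t) ^ ((2 + ρ)⁻¹ - 1))) • ys) ∧
      Tendsto (fun j : ℕ => ((-((l ^ (2 + ρ)) ^ j * τ₀)) ^ (-(2 + ρ)⁻¹)) • X ((l ^ (2 + ρ)) ^ j * τ₀)) atTop (𝓝 ys) := by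
  have hl0 : 0 < l := zero_lt_one.trans hl
  set n : ℝ := (2 + ρ)⁻¹ with hn
  set T : ℝ := l ^ (2 + ρ) with hT
  have hT1 : 1 < T := Real.one_lt_rpow hl hρ
  have hT0 : 0 < T := zero_lt_one.trans hT1
  set N : Set (EuclideanSpace ℝ (Fin 3)) := {y | ‖y‖ ≤ R ∧
    ∀ t : ℝ, t < 0 → u t ((-t) ^ n • y) = (-(n * (-t) ^ (n - 1))) • y} with hNdef
  set Y : ℕ → EuclideanSpace ℝ (Fin 3) := fun j => ((-(T ^ j * τ₀)) ^ (-n)) • X (T ^ j * τ₀) with hY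
  have hsj0 : ∀ j : ℕ, T ^ j * τ₀ < 0 := fun j => mul_neg_of_pos_of_neg (pow_pos hT0 _) hτ₀
  have hsjτ : ∀ j : ℕ, T ^ j * τ₀ ≤ τ₀ := fun j => by
    have : 1 ≤ T ^ j := one_le_pow₀ hT1.le
    nlinarith
  have hs_bot : Tendsto (fun j : ℕ => T ^ j * τ₀) atTop atBot :=
    (tendsto_pow_atTop_atTop_of_one_lt hT1).atTop_mul_const_of_neg hτ₀
  have hneg_inv : ∀ s : ℝ, s < 0 → (-s) ^ (-n) = ((-s) ^ n)⁻¹ := fun s hs => Real.rpow_neg (by linarith) n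
  -- `‖Y j‖ ≤ R`
  have hYR : ∀ j, ‖Y j‖ ≤ R := by
    intro j
    have hs0 : 0 < -(T ^ j * τ₀) := by linarith [hsj0 j]
    have hp : 0 < (-(T ^ j * τ₀)) ^ n := Real.rpow_pos_of_pos hs0 _
    simp only [hY]
    rw [norm_smul, Real.norm_eq_abs, hneg_inv _ (hsj0 j), abs_of_pos (inv_pos.2 hp), inv_mul_le_iff₀ hp]
    linarith [hconf _ (hsjτ j)]
  -- every cluster point of a subsequence of `Y` is a permanent node of the ball
  have hcluster : ∀ φ : ℕ → ℕ, StrictMono φ → ∀ ys, Tendsto (Y ∘ φ) atTop (𝓝 ys) → ys ∈ N := by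
    intro φ hφ ys hys
    refine ⟨le_of_tendsto' (continuous_norm.continuousAt.tendsto.comp hys) fun j => hYR _, ?_⟩
    exact permanentNode_of_tendsto_simPos hcl hl hρ hdss hX hrest (sq := fun j => T ^ (φ j) * τ₀) (fun j => hsj0 _)
      (hs_bot.comp hφ.tendsto_atTop) hys
  -- step A: eventually `Y j` is `ε`-close to `N`
  have hnear : ∀ ε : ℝ, 0 < ε → ∀ᶠ j in atTop, ∃ z ∈ N, dist (Y j) z < ε := by
    intro ε hε
    by_contra hcon
    rw [not_eventually] at hcon
    obtain ⟨φ, hφ, hφP⟩ := extraction_of_frequently_atTop hcon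
    have hK : IsCompact (closedBall (0 : EuclideanSpace ℝ (Fin 3)) R) := isCompact_closedBall _ _
    obtain ⟨ys, -, ψ, hψ, hlim⟩ := hK.tendsto_subseq (x := Y ∘ φ) fun j => mem_closedBall_zero_iff.2 (hYR _)
    have hysN : ys ∈ N := hcluster (φ ∘ ψ) (hφ.comp hψ) ys hlim
    have hev := (hlim.eventually (Metric.ball_mem_nhds ys hε)).exists
    obtain ⟨j, hj⟩ := hev
    exact hφP (ψ j) ⟨ys, hysN, by simpa [dist_comm] using hj⟩
  -- step B: separation of the finite node set, and successive positions are close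
  obtain ⟨δ, hδ0, hsep⟩ := exists_separation_of_finite hfin
  have hstep : ∀ᶠ j in atTop, dist (Y (j + 1)) (Y j) < δ / 3 := by
    have hε' : 0 < δ / 3 / (2 * T) := by positivity
    obtain ⟨M, hM⟩ := eventually_atBot.1 (hrest.eventually (gt_mem_nhds hε'))
    obtain ⟨J, hJ⟩ := eventually_atTop.1 (hs_bot.eventually (eventually_le_atBot M))
    refine eventually_atTop.2 ⟨J, fun j hj => ?_⟩
    have hs's : T ^ (j + 1) * τ₀ ≤ T ^ j * τ₀ := by
      have h := hsj0 j
      rw [pow_succ]; nlinarith [h, hT1]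
    have hmv := norm_simPos_sub_le (u := u) (n := n) (T := T) (ε := δ / 3 / (2 * T)) (s' := T ^ (j + 1) * τ₀) (s := T ^ j * τ₀)
      (hsj0 j) hs's (le_of_eq (by rw [pow_succ]; ring)) hX
      (fun σ hσ => by
        rw [norm_smul, Real.norm_eq_abs, abs_of_nonneg (Real.rpow_nonneg (by linarith [hσ.2, hsj0 j]) _)]
        exact (hM σ (hσ.2.trans (hJ j hj))).le)
    rw [dist_eq_norm, ← norm_neg, neg_sub]
    simp only [hY]
    refine lt_of_le_of_lt hmv ?_
    rw [div_mul_eq_mul_div, div_lt_iff₀ (by positivity)]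
    nlinarith
  -- step C: the nearby node is eventually constant
  obtain ⟨J, hJ⟩ := eventually_atTop.1 ((hnear (δ / 3) (by positivity)).and hstep)
  choose z hzN hzd using fun j => (hJ (j + J) (Nat.le_add_left _ _)).1
  have hzconst : ∀ j, z j = z 0 := by
    intro j
    induction j with
    | zero => rfl
    | succ j ih =>
        rw [← ih]
        by_contra hne
        have h1 := hsep _ (hzN (j + 1)) _ (hzN j) hne
        have h2 : dist (Y (j + 1 + J)) (Y (j + J)) < δ / 3 := by
          have := (hJ (j + J) (Nat.le_add_left _ _)).2
          rwa [show j + 1 + J = j + J + 1 by ring]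
        have h3 := hzd (j + 1)
        rw [dist_comm] at h3
        have h4 := hzd j
        have : dist (z (j + 1)) (z j) ≤ dist (z (j + 1)) (Y (j + 1 + J)) + dist (Y (j + 1 + J)) (Y (j + J)) + dist (Y (j + J)) (z j) :=
          dist_triangle4 _ _ _ _
        linarith
  set ys := z 0 with hys
  refine ⟨ys, (hzN 0).1, (hzN 0).2, ?_⟩
  -- step D: convergence to `ys`
  rw [Metric.tendsto_atTop]
  intro ε hε
  obtain ⟨J', hJ'⟩ := eventually_atTop.1 (hnear (min ε (δ / 3)) (by positivity))
  refine ⟨J + J', fun j hj => ?_⟩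
  obtain ⟨z', hz'N, hz'd⟩ := hJ' j (by omega)
  -- `z' = ys`: both are `δ/3`-close to `Y j`, which is `δ/3`-close to `z (j − J) = ys`
  obtain ⟨i, rfl⟩ : ∃ i, j = i + J := ⟨j - J, by omega⟩
  have hd1 : dist (Y (i + J)) ys < δ / 3 := by rw [← hzconst i]; exact hzd i
  have hz'eq : z' = ys := by
    by_contra hne
    have h1 := hsep _ hz'N _ (hzN 0) hne
    have h2 : dist z' ys ≤ dist z' (Y (i + J)) + dist (Y (i + J)) ys := dist_triangle _ _ _
    have h3 : dist (Y (i + J)) z' < δ / 3 := lt_of_lt_of_le hz'd (min_le_right _ _)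
    rw [dist_comm] at h3
    linarith
  rw [hz'eq] at hz'd
  exact lt_of_lt_of_le hz'd (min_le_left _ _)

end Summit.NavierStokesRegularity.NavierStokesRegularity.Theorems.PowerGaugeEulerLiouville.DSSNodes

end
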